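import Literature.Computability.AlgebraicComplexity.IMMStarSupports
import Literature.Computability.AlgebraicComplexity.BlockSecondMoment
import HarnessLib

/-!
# The expectation of `T₂` for `IMM^*` (Kumar–Saraf 2017, Lemmas 8.4, 8.6, Prop. 9.1)

Topic `Literature/Computability/AlgebraicComplexity`; infrastructure for the printed proof of
`kumarSaraf2017_imm_homDepthFour` (`HomogeneousDepthFour.lean`), Step 5 of the roadmap
(assembly over the blocks). For the block layout with `r ≥ 1` blocks of `k` regular layers, row
degrees `deg`, a transversal `α`, shift degree `m` and `a := N' - r k` (`N'` = number of variables),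
the pair-correlation sum
`T₂X(ξ) = ∑_{v ≠ w good} C(N' - |X v ∪ X w|, m)` (`X v` = the regular entries of `v`, i.e. the
monomial of `v` in `∂_α ρ_{J,V} IMM`, `IMMStarSupports.lean`) satisfies, summed over all row choices
`ξ ∈ Ξ^r` (`Ξ = rowSpace deg` per block),
`∑_ξ T₂X(ξ) ≤ |Ξ|^r · C(a, m) · (∏_j deg_j)^r · ((∏_j deg_j) θ^k Ψ)^r`
(**`sum_T2X_le`**), where `θ = (a-m)/a`, `D = a/(a-m)` and
`Ψ = ∑_{A ⊆ [k]} runWeight (D/deg) (1/ñ) true A` (`≤ 12 + κ` by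
`sum_runWeight_le_of_sameStart`). Since `T₁ = (∏ deg)^r · C(a, m)` for every `ξ`
(`card_support_deriv_immStar`, `card_sSet`), this is [KS, Lemma 8.6]:
`E[T₂(α)] ≤ T₁(α) · ((∏ deg) D^{-k} Ψ)^r = T₁(α) · O(1)^{r}` once `∏ deg ≈ D^k`.

Ingredients: `choose_sub_mul_pow_le` (`C(a-Δ, m) a^Δ ≤ C(a, m) (a-m)^Δ`), the distance formula
`card_xSupport_union_add`, the product structure of the good walks (`sum_goodWalks_eq_sum_pi`) and
of the sample space (`Finset.prod_univ_sum`), and the per-block second moment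
`block_pair_sum_le_sameStart`. The bound is combined with the `T₃` estimate of
`T3Expectation.lean` in `KSMain.lean` (`exists_good_restriction`).

Everything is proved; no named facts.

## References

* M. Kumar, S. Saraf, *On the power of homogeneous depth 4 arithmetic circuits*, SIAM J. Comput.
  46 (2017) 336–387 (arXiv:1404.1950): Lemmas 8.4, 8.6, Prop. 9.1, §9.3.
-/

noncomputable section

namespace Literature.Computability.AlgebraicComplexity.KumarSaraf

open Finset IMMWalk

/-! ### A binomial ratio -/

/-- `C(a - Δ, m) · a^Δ ≤ C(a, m) · (a - m)^Δ` for `Δ ≤ a` (termwise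
`(a - m - i)/(a - i) ≤ (a - m)/a`): the comparison `C(N-k-Δ, m) ≈ C(N-k, m) ((N-m)/N)^Δ` of
[KS, Lemma 9.6], as an inequality. [cite: KumarSaraf2017, Lemma 9.6] -/
theorem choose_sub_mul_pow_le (a m : ℕ) : ∀ Δ : ℕ, Δ ≤ a →
    (a - Δ).choose m * a ^ Δ ≤ a.choose m * (a - m) ^ Δ := by
  intro Δ
  induction Δ with
  | zero => intro; simp
  | succ Δ ih =>
    intro hΔ
    have ih' := ih (Nat.le_of_succ_le hΔ)
    -- `C(a-Δ-1, m) (a-Δ) = C(a-Δ, m) (a-Δ-m)`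
    have hrec : (a - (Δ + 1)).choose m * (a - Δ) = (a - Δ).choose m * (a - Δ - m) := by
      have h := Nat.choose_mul_succ_eq (a - (Δ + 1)) m
      have e1 : a - (Δ + 1) + 1 = a - Δ := by omega
      rw [e1] at h
      exact h
    -- `C(a-Δ-1, m) a ≤ C(a-Δ, m) (a - m)`
    have hstep : (a - (Δ + 1)).choose m * a ≤ (a - Δ).choose m * (a - m) := by
      have hpos : 0 < a - Δ := by omega
      refine Nat.le_of_mul_le_mul_right ?_ hpos
      calc (a - (Δ + 1)).choose m * a * (a - Δ) = ((a - (Δ + 1)).choose m * (a - Δ)) * a := by ring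
        _ = (a - Δ).choose m * ((a - Δ - m) * a) := by rw [hrec]; ring
        _ ≤ (a - Δ).choose m * ((a - m) * (a - Δ)) := Nat.mul_le_mul_left _ ?_
        _ = (a - Δ).choose m * (a - m) * (a - Δ) := by ring
      -- `(a - Δ - m) a ≤ (a - m)(a - Δ)`
      by_cases hm : m ≤ a - Δ
      · have h1 : a - Δ ≤ a := Nat.sub_le a Δ
        zify [hm, h1, (hm.trans h1)]
        nlinarith
      · rw [Nat.sub_eq_zero_of_le (not_le.1 hm).le, zero_mul]; exact Nat.zero_le _
    calc (a - (Δ + 1)).choose m * a ^ (Δ + 1) = ((a - (Δ + 1)).choose m * a) * a ^ Δ := by ring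
      _ ≤ ((a - Δ).choose m * (a - m)) * a ^ Δ := Nat.mul_le_mul_right _ hstep
      _ = ((a - Δ).choose m * a ^ Δ) * (a - m) := by ring
      _ ≤ (a.choose m * (a - m) ^ Δ) * (a - m) := Nat.mul_le_mul_right _ ih'
      _ = a.choose m * (a - m) ^ (Δ + 1) := by ring

/-- The real form: `C(a - Δ, m) ≤ C(a, m) θ^Δ` with `θ = (a - m)/a` (`a ≥ 1`, `Δ ≤ a`).
[cite: KumarSaraf2017, Lemma 9.6] -/
theorem choose_sub_le_mul_pow {a m Δ : ℕ} (ha : 0 < a) (hΔ : Δ ≤ a) :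
    ((a - Δ).choose m : ℝ) ≤ (a.choose m : ℝ) * (((a - m : ℕ) : ℝ) / a) ^ Δ := by
  have h := choose_sub_mul_pow_le a m Δ hΔ
  have hcast : ((a - Δ).choose m : ℝ) * (a : ℝ) ^ Δ ≤ (a.choose m : ℝ) * ((a - m : ℕ) : ℝ) ^ Δ := by
    exact_mod_cast h
  have hapos : (0 : ℝ) < (a : ℝ) ^ Δ := by positivity
  rw [div_pow, ← mul_div_assoc, le_div_iff₀ hapos]
  exact hcast

/-! ### Product structure of double sums over tuples -/

/-- `∑_{p ∈ Π s} ∑_{q ∈ Π s} ∏_b f_b(p_b, q_b) = ∏_b ∑_{x, y ∈ s_b} f_b(x, y)`. [folklore] -/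
theorem sum_pi_sum_pi_prod {ι : Type*} [Fintype ι] [DecidableEq ι] {γ : Type*} [DecidableEq γ]
    (s : ι → Finset γ) (f : ι → γ → γ → ℝ) :
    ∑ p ∈ Fintype.piFinset s, ∑ q ∈ Fintype.piFinset s, ∏ b, f b (p b) (q b) =
      ∏ b, ∑ x ∈ s b, ∑ y ∈ s b, f b x y := by
  have inner : ∀ p : ι → γ, ∑ q ∈ Fintype.piFinset s, ∏ b, f b (p b) (q b) =
      ∏ b, ∑ y ∈ s b, f b (p b) y := fun p => (Finset.prod_univ_sum s fun b y => f b (p b) y).symm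
  rw [sum_congr rfl fun p _ => inner p]
  exact (Finset.prod_univ_sum s fun b x => ∑ y ∈ s b, f b x y).symm

/-! ### The `T₂` sum -/

variable {r k e N : ℕ} (hN : 0 < N)

/-- The blocks of an assembled walk. [folklore] -/
theorem toBlocks_ofBlocks (p : Fin r → Walk k N) : toBlocks (e := e) (ofBlocks hN p) = p := by
  funext b i; exact ofBlocks_posX hN p b i

/-- **The pair-correlation sum `T₂` restricted to the regular part** (Kumar–Saraf 2017, §8.5): over
ordered pairs of distinct good walks, the number of multilinear shifts of degree `m` disjoint from
both monomials, `C(N' - |X v ∪ X w|, m)` (`card_sSet_inter`). [cite: KumarSaraf2017, §8.5] -/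
def T2X (Nvars m : ℕ) (ξ : Fin r → Fin k × Fin N → Finset (Fin N)) (α : Fin r → Fin N) : ℕ :=
  ∑ v ∈ goodWalks (e := e) hN ξ α, ∑ w ∈ (goodWalks (e := e) hN ξ α).erase v,
    (Nvars - (xSupport (e := e) v ∪ xSupport w).card).choose m

/-- **Bounding a `T₂` term by block agreements**: with `N' = a + r k`, `Δ ≤ a`... precisely, for
walks `v, w`, `C(N' - |X v ∪ X w|, m) ≤ C(a, m) θ^{rk} ∏_b D^{|agree_b|}` where `θ = (a-m)/a`,
`D = a/(a-m)`. [cite: KumarSaraf2017, §9.3] -/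
theorem T2_term_le {a m : ℕ} (ha : 0 < a) (hma : m < a) (hrk : r * k ≤ a)
    (v w : Fin (nL r k e) → Fin N) :
    (((a + r * k) - (xSupport (e := e) v ∪ xSupport w).card).choose m : ℝ) ≤
      (a.choose m : ℝ) * (((a - m : ℕ) : ℝ) / a) ^ (r * k) *
        ∏ b : Fin r, ((a : ℝ) / ((a - m : ℕ) : ℝ)) ^ (agree (toBlocks (e := e) v b) (toBlocks w b)).card := by
  set A := ∑ b : Fin r, (agree (toBlocks (e := e) v b) (toBlocks w b)).card with hA
  have hunion := card_xSupport_union_add (e := e) v w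
  have hAle : A ≤ r * k := by
    rw [hA]
    calc ∑ b : Fin r, (agree (toBlocks (e := e) v b) (toBlocks w b)).card ≤ ∑ _b : Fin r, k :=
          sum_le_sum fun b _ => by
            rw [agree]; exact (card_filter_le _ _).trans (by rw [card_univ, Fintype.card_fin])
      _ = r * k := by rw [sum_const, card_univ, Fintype.card_fin, smul_eq_mul]
  -- `N' - |X ∪ X| = a - Δ` with `Δ = rk - A`
  have hΔ : (a + r * k) - (xSupport (e := e) v ∪ xSupport w).card = a - (r * k - A) := by omega
  rw [hΔ]
  have hθpos : (0 : ℝ) < ((a - m : ℕ) : ℝ) := by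
    have : 0 < a - m := by omega
    exact_mod_cast this
  have hapos : (0 : ℝ) < a := by exact_mod_cast ha
  refine (choose_sub_le_mul_pow (m := m) ha (by omega)).trans (le_of_eq ?_)
  -- `θ^{rk - A} = θ^{rk} D^A`
  rw [prod_pow_eq_pow_sum, ← hA, mul_assoc]
  congr 1
  rw [div_pow, div_pow, div_pow]
  field_simp
  have e1 : (a : ℝ) ^ (r * k) = (a : ℝ) ^ (r * k - A) * (a : ℝ) ^ A := by
    rw [← pow_add, Nat.sub_add_cancel hAle]
  have e2 : ((a - m : ℕ) : ℝ) ^ (r * k) = ((a - m : ℕ) : ℝ) ^ (r * k - A) * ((a - m : ℕ) : ℝ) ^ A := by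
    rw [← pow_add, Nat.sub_add_cancel hAle]
  rw [e1, e2]; ring

/-- Walks from a fixed start: at most `ñ^k`. [folklore] -/
theorem card_walks_from_le (s : Fin N) :
    ((univ : Finset (Walk k N)).filter fun p => p 0 = s).card ≤ N ^ k := by
  classical
  have h := card_walks_prescribed_le (fun _ : Fin (k + 1) => s) ({0} : Finset (Fin (k + 1)))
  rw [card_singleton, Nat.add_sub_cancel] at h
  refine le_trans (le_of_eq ?_) h
  congr 1; ext p; simp

/-- **Per block, summed over the row choices** ([KS, Prop. 9.1]): for a start `s`,
`∑_{ξ ∈ Ξ} ∑_{p, q from s alive} D^{|agree p q|} ≤ |Ξ| (∏ deg)² Ψ`.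
[cite: KumarSaraf2017, Prop. 9.1] -/
theorem block_double_sum_le (deg : Fin k → ℕ) (hdeg : ∀ j, 1 ≤ deg j) (hN1 : 1 ≤ N) {D : ℝ}
    (hD : 0 ≤ D) (s : Fin N) :
    ∑ ξ ∈ rowSpace (fun ρ : Fin k × Fin N => deg ρ.1),
      ∑ p ∈ (univ : Finset (Walk k N)).filter (fun p => p 0 = s ∧ Alive ξ p),
        ∑ q ∈ (univ : Finset (Walk k N)).filter (fun q => q 0 = s ∧ Alive ξ q),
          D ^ (agree p q).card ≤
      ((rowSpace (α := Fin N) (fun ρ : Fin k × Fin N => deg ρ.1)).card : ℝ) *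
        (∏ j, (deg j : ℝ)) ^ 2 * ∑ A ∈ (range k).powerset, runWeight (wOf D deg) (1 / N) true A := by
  classical
  set Ξ := rowSpace (α := Fin N) (fun ρ : Fin k × Fin N => deg ρ.1) with hΞ
  set Ps := (univ : Finset (Walk k N)).filter (fun p => p 0 = s) with hPs
  set Ψ := ∑ A ∈ (range k).powerset, runWeight (wOf D deg) (1 / N) true A with hΨ
  -- rewrite the alive-restricted sums as indicator sums over all walks from `s`
  have hrew : ∀ ξ ∈ Ξ, ∑ p ∈ (univ : Finset (Walk k N)).filter (fun p => p 0 = s ∧ Alive ξ p),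
      ∑ q ∈ (univ : Finset (Walk k N)).filter (fun q => q 0 = s ∧ Alive ξ q), D ^ (agree p q).card =
      ∑ p ∈ Ps, ∑ q ∈ Ps, if Alive ξ p ∧ Alive ξ q then D ^ (agree p q).card else 0 := by
    intro ξ _
    have hf : (univ : Finset (Walk k N)).filter (fun p => p 0 = s ∧ Alive ξ p) =
        Ps.filter fun p => Alive ξ p := by
      rw [hPs, filter_filter]
    rw [hf, sum_filter]
    refine sum_congr rfl fun p _ => ?_
    split_ifs with hp
    · rw [sum_filter]
      refine sum_congr rfl fun q _ => ?_
      by_cases hq : Alive ξ q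
      · rw [if_pos hq, if_pos ⟨hp, hq⟩]
      · rw [if_neg hq, if_neg (fun h => hq h.2)]
    · symm
      refine sum_eq_zero fun q _ => ?_
      rw [if_neg (fun h => hp h.1)]
  rw [sum_congr rfl hrew, sum_comm]
  simp_rw [sum_comm (s := Ξ) (t := Ps)]
  -- the inner sum over `ξ` is the pair count
  have hcnt : ∀ p q : Walk k N, ∑ ξ ∈ Ξ, (if Alive ξ p ∧ Alive ξ q then D ^ (agree p q).card else 0) =
      ((Ξ.filter fun ξ => Alive ξ p ∧ Alive ξ q).card : ℝ) * D ^ (agree p q).card := by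
    intro p q
    rw [← sum_filter, sum_const, nsmul_eq_mul]
  simp_rw [hcnt]
  have hps0 : ∀ p ∈ Ps, p 0 = s := fun p hp => (mem_filter.1 hp).2
  calc ∑ p ∈ Ps, ∑ q ∈ Ps, ((Ξ.filter fun ξ => Alive ξ p ∧ Alive ξ q).card : ℝ) * D ^ (agree p q).card
      ≤ ∑ _p ∈ Ps, (Ξ.card : ℝ) * (∏ j, (deg j : ℝ)) ^ 2 / (N : ℝ) ^ k * Ψ := by
        refine sum_le_sum fun p hp => ?_
        have h := block_pair_sum_le_sameStart deg hdeg hN1 hD p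
        rw [hps0 p hp] at h
        exact h
    _ = (Ps.card : ℝ) * ((Ξ.card : ℝ) * (∏ j, (deg j : ℝ)) ^ 2 / (N : ℝ) ^ k * Ψ) := by
        rw [sum_const, nsmul_eq_mul]
    _ ≤ ((N : ℝ) ^ k) * ((Ξ.card : ℝ) * (∏ j, (deg j : ℝ)) ^ 2 / (N : ℝ) ^ k * Ψ) := by
        refine mul_le_mul_of_nonneg_right ?_ ?_
        · exact_mod_cast card_walks_from_le s
        · have : 0 ≤ Ψ := sum_nonneg fun A _ => by
            unfold runWeight; exact mul_nonneg (pow_nonneg (by positivity) _)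
              (prod_nonneg fun j _ => wOf_nonneg hD deg j)
          positivity
    _ = (Ξ.card : ℝ) * (∏ j, (deg j : ℝ)) ^ 2 * Ψ := by
        have hNpos : (0 : ℝ) < (N : ℝ) ^ k := by
          have : (0 : ℝ) < N := by exact_mod_cast hN1
          positivity
        field_simp

/-- **Kumar–Saraf 2017, Lemma 8.6 / Prop. 9.1 (`E[T₂]`), counting form.** For `r` blocks of `k`
regular layers on `ñ ≥ 1` vertices, row degrees `deg ≥ 1`, a transversal `α`, a shift degree
`m < a` and `r k ≤ a`:
`∑_{ξ ∈ Ξ^r} T₂X(ξ) ≤ |Ξ|^r · C(a, m) · (∏ deg)^r · ((∏ deg) θ^k Ψ)^r`, `θ = (a-m)/a`.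
[cite: KumarSaraf2017, Lemma 8.6] -/
theorem sum_T2X_le (deg : Fin k → ℕ) (hdeg : ∀ j, 1 ≤ deg j) (hN1 : 1 ≤ N)
    (α : Fin r → Fin N) {a m : ℕ} (ha : 0 < a) (hma : m < a) (hrk : r * k ≤ a) :
    ∑ ξ ∈ Fintype.piFinset (fun _ : Fin r => rowSpace (fun ρ : Fin k × Fin N => deg ρ.1)),
        (T2X (e := e) hN (a + r * k) m ξ α : ℝ) ≤
      ((rowSpace (α := Fin N) (fun ρ : Fin k × Fin N => deg ρ.1)).card : ℝ) ^ r *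
        (a.choose m : ℝ) * (∏ j, (deg j : ℝ)) ^ r *
        ((∏ j, (deg j : ℝ)) * (((a - m : ℕ) : ℝ) / a) ^ k *
          ∑ A ∈ (range k).powerset,
            runWeight (wOf ((a : ℝ) / ((a - m : ℕ) : ℝ)) deg) (1 / N) true A) ^ r := by
  classical
  set θ : ℝ := ((a - m : ℕ) : ℝ) / a with hθ
  set D : ℝ := (a : ℝ) / ((a - m : ℕ) : ℝ) with hD
  set Ξ := rowSpace (α := Fin N) (fun ρ : Fin k × Fin N => deg ρ.1) with hΞ
  set Ψ := ∑ A ∈ (range k).powerset, runWeight (wOf D deg) (1 / N) true A with hΨ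
  have hθ0 : 0 ≤ θ := by rw [hθ]; positivity
  have hD0 : 0 ≤ D := by rw [hD]; positivity
  have hΨ0 : 0 ≤ Ψ := sum_nonneg fun A _ => by
    unfold runWeight
    exact mul_nonneg (pow_nonneg (by positivity) _) (prod_nonneg fun j _ => wOf_nonneg hD0 deg j)
  -- Step 1: bound every `T₂X(ξ)` by the full double sum of `C(a,m) θ^{rk} ∏_b D^{|agree_b|}`
  have hstep1 : ∀ ξ : Fin r → Fin k × Fin N → Finset (Fin N),
      (T2X (e := e) hN (a + r * k) m ξ α : ℝ) ≤ (a.choose m : ℝ) * θ ^ (r * k) *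
        ∑ v ∈ goodWalks (e := e) hN ξ α, ∑ w ∈ goodWalks (e := e) hN ξ α,
          ∏ b : Fin r, D ^ (agree (toBlocks (e := e) v b) (toBlocks w b)).card := by
    intro ξ
    unfold T2X
    push_cast
    rw [mul_sum]
    refine sum_le_sum fun v _ => ?_
    rw [mul_sum]
    calc ∑ w ∈ (goodWalks (e := e) hN ξ α).erase v,
          (((a + r * k) - (xSupport (e := e) v ∪ xSupport w).card).choose m : ℝ)
        ≤ ∑ w ∈ goodWalks (e := e) hN ξ α,
            (((a + r * k) - (xSupport (e := e) v ∪ xSupport w).card).choose m : ℝ) :=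
          sum_le_sum_of_subset_of_nonneg (erase_subset _ _) fun _ _ _ => by positivity
      _ ≤ _ := sum_le_sum fun w _ => by
          have h := T2_term_le (e := e) ha hma hrk v w
          rw [← hθ, ← hD] at h
          linarith [h]
  -- Step 2: the double sum over good walks factors over the blocks
  have hstep2 : ∀ ξ : Fin r → Fin k × Fin N → Finset (Fin N),
      ∑ v ∈ goodWalks (e := e) hN ξ α, ∑ w ∈ goodWalks (e := e) hN ξ α,
          ∏ b : Fin r, D ^ (agree (toBlocks (e := e) v b) (toBlocks w b)).card =
        ∏ b : Fin r, ∑ x ∈ blockGood ξ α b, ∑ y ∈ blockGood ξ α b, D ^ (agree x y).card := by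
    intro ξ
    rw [sum_goodWalks_eq_sum_pi]
    simp_rw [sum_goodWalks_eq_sum_pi (e := e) hN ξ α, toBlocks_ofBlocks]
    exact sum_pi_sum_pi_prod (blockGood ξ α) fun b x y => D ^ (agree x y).card
  -- Step 3: sum over `ξ` and factor over the blocks
  calc ∑ ξ ∈ Fintype.piFinset (fun _ : Fin r => Ξ), (T2X (e := e) hN (a + r * k) m ξ α : ℝ)
      ≤ ∑ ξ ∈ Fintype.piFinset (fun _ : Fin r => Ξ), (a.choose m : ℝ) * θ ^ (r * k) *
          ∏ b : Fin r, ∑ x ∈ blockGood ξ α b, ∑ y ∈ blockGood ξ α b, D ^ (agree x y).card := by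
        refine sum_le_sum fun ξ _ => ?_
        rw [← hstep2]; exact hstep1 ξ
    _ = (a.choose m : ℝ) * θ ^ (r * k) * ∏ b : Fin r, ∑ x ∈ Ξ,
          ∑ p ∈ (univ : Finset (Walk k N)).filter (fun p => p 0 = α b ∧ Alive x p),
            ∑ q ∈ (univ : Finset (Walk k N)).filter (fun q => q 0 = α b ∧ Alive x q),
              D ^ (agree p q).card := by
        rw [← mul_sum]
        congr 1
        have h := Finset.prod_univ_sum (fun _ : Fin r => Ξ) fun b x =>
          ∑ p ∈ (univ : Finset (Walk k N)).filter (fun p => p 0 = α b ∧ Alive x p),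
            ∑ q ∈ (univ : Finset (Walk k N)).filter (fun q => q 0 = α b ∧ Alive x q),
              D ^ (agree p q).card
        rw [h]
        rfl
    _ ≤ (a.choose m : ℝ) * θ ^ (r * k) *
          ∏ _b : Fin r, ((Ξ.card : ℝ) * (∏ j, (deg j : ℝ)) ^ 2 * Ψ) := by
        refine mul_le_mul_of_nonneg_left ?_ (by positivity)
        refine prod_le_prod (fun b _ => sum_nonneg fun x _ => sum_nonneg fun p _ =>
          sum_nonneg fun q _ => by positivity) fun b _ => ?_
        exact block_double_sum_le deg hdeg hN1 hD0 (α b)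
    _ = _ := by
        rw [prod_const, card_univ, Fintype.card_fin, hΨ, hθ]
        rw [show r * k = k * r by ring, pow_mul]
        ring

end Literature.Computability.AlgebraicComplexity.KumarSaraf

end
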